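import Mathlib
import Literature.Geometry.Symplectic.JHolomorphicBranchNormalForm
import Literature.Geometry.Symplectic.JRotationBranchDbar
import Literature.Geometry.Symplectic.JRotationBranchTranslate
import Literature.Geometry.Symplectic.JHolomorphicCuspGlue
import Literature.Geometry.Symplectic.JHolomorphicLocalBranchDichotomy
import Literature.Analysis.Complex.SimilarityFactorisationC1
import HarnessLib

/-!
# The local representation formula with branch comparison (Wendl 2020, App. B, Thm B.23 and (B.12))

Dimension four. **`jHolomorphic_representationFormula`**: for every smooth almost complex structure
`J` on an open set `U` of a real normed space `F` of dimension `4` and every smooth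
`J`-holomorphic `u : B(z₀,R) → U` which is not locally constant at `z₀`, there are `k ≥ 1`, a
smooth chart `Θ` about `u z₀`, a `C¹` chart `ξ` about `z₀` (smooth off `z₀`) and a `C¹` map `û`
with `û = O(|w|^{k+1})` and `Θ (u z) = ((ξ z)ᵏ, û (ξ z))` near `z₀`, such that for every `ℓ`
EITHER `û (e^{2πiℓ/k} w) = û w` near `0`, OR `û (e^{2πiℓ/k} w) - û w = C wᵐ + o(|w|ᵐ)` with
`m > k`, `C ≠ 0` — C. Wendl, *Lectures on Contact 3-Manifolds, Holomorphic Curves and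
Intersection Theory* (2020), App. B, Thm B.23 with (B.12) (after M. Micallef and B. White, Ann. of
Math. 141 (1995), Thm 6.1/6.2). This is VERBATIM the hypothesis `hX` of
`Literature.Geometry.Symplectic.CuspDoublePoints.jHolomorphic_immersed_of_limitEmbedded_punctured_of_representationFormula`
(`Literature/Geometry/Symplectic/JHolomorphicCuspGlue.lean`) and of
`Literature.Geometry.Symplectic.jHolomorphic_localBranchDichotomy_of_representationFormula`
(`Literature/Geometry/Symplectic/JHolomorphicLocalBranchDichotomy.lean`); consequently the two
named facts of McDuff's local theory are DISCHARGED here: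

* `jHolomorphic_immersed_of_limitEmbedded_punctured_holds` — no cusps in `C¹`-limits of embedded
  `J`-curves (D. McDuff, J. Differential Geom. 34 (1991), Thm 1.4 / Cor. 4.4);
* `jHolomorphic_localBranchDichotomy_holds` — the local branch dichotomy (McDuff 1991 Lemma 2.7 /
  Lemma 5.3; Wendl, Lectures, Thm 2.88).

## Proof of the formula (Wendl 2020, §B.2.3–§B.2.5)

The normal form `Θ (u z) = ((ξ z)ᵏ, û (ξ z))` in a chart adapted to `J` along the tangent axis,
with `Dξ(z₀) = 𝟙` and Lemma B.29, is
`Literature.Geometry.Symplectic.BranchNormalForm.exists_adaptedNormalForm`. Fix `ℓ` and the root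
of unity `ε̄ = e^{2πiℓ/k}`. The rotated branch `θ(s) ≈ ε̄ s` and its normal coordinate `η(s)`
solve Wendl's equation (B.20) for the normal frame `X = NormalPushoff.frame J₂`
(`RotationBranch.exists_regular_branch`, Lemma B.35). In the ORIGINAL variable `ζ = z - z₀` the
coordinate `f ζ = η (ξ (z₀ + ζ))` satisfies the hypotheses of the punctured similarity principle
(`RotationBranch.dbar_normalCoordinate`: Prop. B.28 through `NormalPushoff.norm_dbar_le_of_pushoff`
and the projector of `JTransverseProjector`), so by
`Literature.Analysis.Complex.similarity_dichotomy_punctured'` (Thm B.20 / Cor. B.21) either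
`f ≡ 0` near `0` or `f ζ / ζᵐ → A ≠ 0` with `m ≥ k + 1`. Back in the chart variable `s`
(`RotationBranch.tendsto_symm_sub`, `RotationBranch.tendsto_symm_sub_div`: `ξ⁻¹ s - z₀ = s + o(s)`)
this reads `η ≡ 0`, resp. `η(s)/sᵐ → A`, and the translation lemmas of
`Literature/Geometry/Symplectic/JRotationBranchTranslate.lean` (`RotationBranch.rotation_comparison_landau`)
turn these into `û (ε̄ w) = û w` near `0`, resp. `û (ε̄ w) - û w = -A wᵐ + o(|w|ᵐ)`.

Everything is proved; no named facts remain in this chain.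

## References

* C. Wendl, *Lectures on Contact 3-Manifolds, Holomorphic Curves and Intersection Theory*,
  Cambridge Tracts in Math. 220 (2020), App. B, Thm B.20, Cor. B.21, Thm B.23 ((B.12)), (B.20),
  Prop. B.28, Lemmas B.29–B.35, §B.2.3–§B.2.5. [Wendl2020]
* M. Micallef, B. White, *The structure of branch points in minimal surfaces and in
  pseudoholomorphic curves*, Ann. of Math. 141 (1995) 35–85, Thms 6.1, 6.2. [MicallefWhite1995]
* D. McDuff, *The local behaviour of holomorphic curves in almost complex 4-manifolds*,
  J. Differential Geom. 34 (1991) 143–164, Thm 1.4, Cor. 4.4, Lemma 2.7. [McDuff1991LocalBehaviour]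
-/

noncomputable section

open scoped Topology ContDiff
open Set Filter Metric Complex Asymptotics
open Literature.Analysis.Complex

namespace Literature.Geometry.Symplectic

/-- The `k`-th roots of unity `e^{2πiℓ/k}`: `k`-th power `1` and norm `1` (`k ≠ 0`). [folklore] -/
theorem rootOfUnity_pow_norm {k : ℕ} (hk : k ≠ 0) (ℓ : ℕ) :
    Complex.exp (2 * Real.pi * Complex.I * (ℓ / k : ℂ)) ^ k = 1 ∧
      ‖Complex.exp (2 * Real.pi * Complex.I * (ℓ / k : ℂ))‖ = 1 := by
  have hkC : (k : ℂ) ≠ 0 := Nat.cast_ne_zero.2 hk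
  constructor
  · rw [← Complex.exp_nat_mul]
    have : (k : ℂ) * (2 * Real.pi * Complex.I * (ℓ / k : ℂ)) = ℓ * (2 * Real.pi * Complex.I) := by
      field_simp
    rw [this]
    exact Complex.exp_nat_mul_two_pi_mul_I ℓ
  · have : 2 * (Real.pi : ℂ) * Complex.I * (ℓ / k : ℂ) = ((2 * Real.pi * ℓ / k : ℝ) : ℂ) * Complex.I := by
      push_cast; ring
    rw [this]
    exact Complex.norm_exp_ofReal_mul_I _

/-- **The local representation formula with branch comparison** (Wendl 2020, App. B, Thm B.23
with (B.12); Micallef–White 1995, Thms 6.1/6.2), in exactly the form `hX` consumed by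
`CuspDoublePoints.jHolomorphic_immersed_of_limitEmbedded_punctured_of_representationFormula` and
`jHolomorphic_localBranchDichotomy_of_representationFormula`. See the module docstring for the
statement and the proof. [cite: Wendl2020, App. B, Thm B.23] -/
theorem jHolomorphic_representationFormula :
    ∀ (F : Type) [NormedAddCommGroup F] [NormedSpace ℝ F] [FiniteDimensional ℝ F],
      Module.finrank ℝ F = 4 →
      ∀ (J : F → F →L[ℝ] F) (U : Set F), IsOpen U → ContDiffOn ℝ ∞ J U →
        (∀ x ∈ U, ∀ v : F, J x (J x v) = -v) →
      ∀ (u : ℂ → F) (z₀ : ℂ) (R : ℝ), 0 < R → ContDiffOn ℝ ∞ u (ball z₀ R) →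
        MapsTo u (ball z₀ R) U →
        (∀ z ∈ ball z₀ R, ∀ α : ℂ, fderiv ℝ u z (Complex.I * α) = J (u z) (fderiv ℝ u z α)) →
        (∃ᶠ z in 𝓝 z₀, u z ≠ u z₀) →
        ∃ (k : ℕ) (Θ : OpenPartialHomeomorph F (ℂ × ℂ)) (ξ : OpenPartialHomeomorph ℂ ℂ)
          (uhat : ℂ → ℂ) (ρ ρ₁ : ℝ),
          0 < k ∧ 0 < ρ ∧ 0 < ρ₁ ∧
          u z₀ ∈ Θ.source ∧ Θ (u z₀) = 0 ∧ ContDiffOn ℝ ∞ Θ Θ.source ∧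
            ContDiffOn ℝ ∞ Θ.symm Θ.target ∧
          ball z₀ ρ ⊆ ξ.source ∧ ξ z₀ = 0 ∧ ContDiffOn ℝ 1 ξ ξ.source ∧
            ContDiffOn ℝ 1 ξ.symm ξ.target ∧ ContDiffOn ℝ ∞ ξ (ξ.source \ {z₀}) ∧
          MapsTo ξ (ball z₀ ρ) (ball 0 ρ₁) ∧ ContDiffOn ℝ 1 uhat (ball 0 ρ₁) ∧
            (uhat =O[𝓝 0] fun w : ℂ => ‖w‖ ^ (k + 1)) ∧
            (∀ z ∈ ball z₀ ρ, u z ∈ Θ.source ∧ Θ (u z) = ((ξ z) ^ k, uhat (ξ z))) ∧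
          ∀ ℓ : ℕ,
            (∀ᶠ w in 𝓝 (0 : ℂ),
              uhat (Complex.exp (2 * Real.pi * Complex.I * (ℓ / k : ℂ)) * w) = uhat w) ∨
            ∃ (m : ℕ) (C : ℂ), k < m ∧ C ≠ 0 ∧
              (fun w : ℂ =>
                  uhat (Complex.exp (2 * Real.pi * Complex.I * (ℓ / k : ℂ)) * w) - uhat w -
                    C * w ^ m)
                =o[𝓝 (0 : ℂ)] fun w : ℂ => ‖w‖ ^ m := by
  intro F _ _ _ hF J U hU hJ hJ2 u z₀ R hR hu huU hhol hnc
  obtain ⟨k, Θ, J₂, ξ, uhat, r, C, ρ, ρ₁, hk, hr, hρ, hρR, hρ₁, hC, hpsrc, hΘp, hΘsmooth, hΘsymm,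
    hJ₂smooth, hJ₂2, hJ₂0, haxis, husrc, hghol, -, hb2, hsrc, htgt, hξ0, hfd0, hξC1, hξsymmC1,
    hξsmooth, hmaps, huhatC1, huhat1, huhat2, hnf⟩ :=
    BranchNormalForm.exists_adaptedNormalForm F hF J U hU hJ hJ2 u z₀ R hR hu huU hhol hnc
  have hk' : k ≠ 0 := Nat.pos_iff_ne_zero.1 hk
  have hz₀src : z₀ ∈ ξ.source := hsrc (mem_ball_self hρ)
  have h0tgt : (0 : ℂ × ℂ) ∈ Θ.target := hΘp ▸ Θ.map_source hpsrc
  refine ⟨k, Θ, ξ, uhat, ρ, ρ₁, hk, hρ, hρ₁, hpsrc, hΘp, hΘsmooth, hΘsymm, hsrc, hξ0, hξC1, hξsymmC1,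
    hξsmooth, hmaps, huhatC1, ?_, fun z hz => ⟨husrc hz, hnf z hz⟩, fun ℓ => ?_⟩
  · -- `û = O(|w|^{k+1})`
    refine Asymptotics.IsBigO.of_bound C ?_
    filter_upwards [ball_mem_nhds (0 : ℂ) hρ₁] with w hw
    rw [Real.norm_of_nonneg (by positivity)]
    exact huhat1 w hw
  -- ### the rotation comparison for the root of unity `ε̄ = e^{2πiℓ/k}`
  obtain ⟨hε, hεn⟩ := rootOfUnity_pow_norm hk' ℓ
  set εb : ℂ := Complex.exp (2 * Real.pi * Complex.I * (ℓ / k : ℂ)) with hεb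
  set X : ℂ × ℂ → ℂ →L[ℝ] ℂ × ℂ := NormalPushoff.frame J₂ with hX_def
  -- frame estimates and the regular branch (for the translation lemmas)
  have haxis' : ∀ q : ℂ, ‖q‖ < r → ((q, (0 : ℂ)) : ℂ × ℂ) ∈ Θ.target ∧
      J₂ (q, 0) (0, 1) = (0, I) := fun q hq =>
    ⟨(haxis q hq).1, by simpa using (haxis q hq).2 1⟩
  obtain ⟨CX, δX, hCX, hδX, -, hδXV, hX1, -, hX2⟩ :=
    NormalPushoff.exists_frame_estimates (Jt := J₂) Θ.open_target h0tgt hJ₂smooth hr haxis'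
  have hXc : ContDiffOn ℝ 1 X Θ.target :=
    (NormalPushoff.contDiffOn_frame hJ₂smooth).of_le (by norm_cast)
  obtain ⟨hzeroT, hlimT⟩ := RotationBranch.rotation_comparison_landau (k := k) (εb := εb) (uh := uhat)
    (X := X) hk' hε hεn hC hCX hρ₁ hδX Θ.open_target hδXV hXc huhatC1 huhat1 huhat2 hX1 hX2
  -- the normal coordinate in the original variable and the similarity dichotomy
  have hu' : ContDiffOn ℝ ∞ u (ball z₀ ρ) := hu.mono (ball_subset_ball hρR)
  obtain ⟨R', C', B', M, hR', hfC1, hfb, hfD, hfdbar⟩ :=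
    RotationBranch.dbar_normalCoordinate (εb := εb) hk hr hρ hρ₁ hC hε hεn hu' hpsrc hΘp hΘsmooth
      hJ₂smooth hJ₂2 hJ₂0 haxis husrc hghol hb2 hsrc htgt hξ0 hfd0 hξC1 hξsymmC1 hξsmooth huhatC1
      huhat1 huhat2 hnf
  set SOL : ℂ → ℂ × ℂ := RotationBranch.sol k εb uhat X (2 * C + 1) with hSOL
  set f : ℂ → ℂ := fun ζ => (SOL (ξ (z₀ + ζ))).2 with hf_def
  -- the chart variable: `ζ(s) = ξ⁻¹ s - z₀`
  have hζt : Tendsto (fun s => ξ.symm s - z₀) (𝓝[≠] 0) (𝓝[≠] 0) :=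
    RotationBranch.tendsto_symm_sub ξ hz₀src hξ0
  have hζdiv : Tendsto (fun s => (ξ.symm s - z₀) / s) (𝓝[≠] 0) (𝓝 1) :=
    RotationBranch.tendsto_symm_sub_div ξ hz₀src hξ0 hξC1 hfd0
  have h0t : (0 : ℂ) ∈ ξ.target := hξ0 ▸ ξ.map_source hz₀src
  have hfs : ∀ᶠ s in 𝓝[≠] (0 : ℂ), f (ξ.symm s - z₀) = (SOL s).2 ∧ ξ.symm s - z₀ ≠ 0 := by
    filter_upwards [mem_nhdsWithin_of_mem_nhds (ξ.open_target.mem_nhds h0t), self_mem_nhdsWithin]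
      with s hs hs0
    have hback : ξ (z₀ + (ξ.symm s - z₀)) = s := by
      rw [add_sub_cancel, ξ.right_inv hs]
    refine ⟨by simp only [hf_def, hback], fun h => ?_⟩
    have h' : ξ.symm s = z₀ := sub_eq_zero.1 h
    exact hs0 (by rw [mem_singleton_iff, ← ξ.right_inv hs, h', hξ0])
  rcases similarity_dichotomy_punctured' f hR' hfC1 hfb hfD hfdbar with hzero | ⟨m, A, hm, hA, hlim, -⟩
  · -- ### first alternative: `η ≡ 0` near `0`, so `û (ε̄ w) = û w`
    left
    have hev : ∀ᶠ s in 𝓝[≠] (0 : ℂ), (SOL s).2 = 0 := by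
      filter_upwards [hζt.eventually hzero, hfs] with s hs hs'
      rw [← hs'.1]; exact hs
    exact hzeroT hev
  · -- ### second alternative: `η(s)/sᵐ → A ≠ 0`, so `û (ε̄ w) - û w = -A wᵐ + o(|w|ᵐ)`
    right
    have hlimS : Tendsto (fun s => (SOL s).2 / s ^ m) (𝓝[≠] 0) (𝓝 A) := by
      have h1 : Tendsto (fun s => f (ξ.symm s - z₀) / (ξ.symm s - z₀) ^ m) (𝓝[≠] 0) (𝓝 A) :=
        hlim.comp hζt
      have h2 : Tendsto (fun s => ((ξ.symm s - z₀) / s) ^ m) (𝓝[≠] 0) (𝓝 (1 ^ m)) := hζdiv.pow m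
      rw [one_pow] at h2
      have h3 := h1.mul h2
      rw [mul_one] at h3
      refine h3.congr' ?_
      filter_upwards [hfs, self_mem_nhdsWithin] with s hs hs0
      obtain ⟨hfs1, hζne⟩ := hs
      have hs0' : s ≠ 0 := hs0
      rw [hfs1, div_pow]
      field_simp
    refine ⟨m, -A, by omega, neg_ne_zero.2 hA, ?_⟩
    exact hlimT m A (by omega) hA hlimS

/-- **McDuff's no-cusp theorem, discharged.** No cusps in `C¹`-limits of embedded `J`-curves
(D. McDuff, J. Differential Geom. 34 (1991), Thm 1.4 / Cor. 4.4): the Literature named fact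
`jHolomorphic_immersed_of_limitEmbedded_punctured` HOLDS, by
`CuspDoublePoints.jHolomorphic_immersed_of_limitEmbedded_punctured_of_representationFormula`
applied to `jHolomorphic_representationFormula`.
[cite: McDuff1991LocalBehaviour, Thm 1.4, Cor. 4.4, Lemma 4.3] -/
theorem jHolomorphic_immersed_of_limitEmbedded_punctured_holds :
    jHolomorphic_immersed_of_limitEmbedded_punctured :=
  CuspDoublePoints.jHolomorphic_immersed_of_limitEmbedded_punctured_of_representationFormula
    jHolomorphic_representationFormula

/-- **The local branch dichotomy, discharged** (McDuff 1991 Lemma 2.7 / Lemma 5.3; Wendl,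
Lectures, Thm 2.88): the Literature named fact `jHolomorphic_localBranchDichotomy` HOLDS, by
`jHolomorphic_localBranchDichotomy_of_representationFormula` applied to
`jHolomorphic_representationFormula`. [cite: WendlLectures2010, Thm 2.88] -/
theorem jHolomorphic_localBranchDichotomy_holds : jHolomorphic_localBranchDichotomy :=
  jHolomorphic_localBranchDichotomy_of_representationFormula jHolomorphic_representationFormula

end Literature.Geometry.Symplectic

end
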